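import Mathlib
import Literature.NumberTheory.LFunctions.Zhang2022.Section14Eq148Leg2Aggregation
import Literature.NumberTheory.LFunctions.Zhang2022.Section14LegTwoBlock
import HarnessLib

/-!
# Zhang (2022) §14, (14.8): the large-conductor leg `D³ ≤ r < 2DP₄` HOLDS (β = 0 node and the
# β-twisted form)

Topic `Literature/NumberTheory/LFunctions/Zhang2022` (Landau–Siegel audit tree; verdict-neutral).
Y. Zhang, *Discrete mean estimates and the Landau–Siegel zero*, arXiv:2211.02515v1 (2022)
[Zhang2022LandauSiegel] — **an unrefereed manuscript under adjudication; nothing in this file bears on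
its Theorems 1–2 or on Landau–Siegel zeros.** §14 p. 79 (tex L3962–L3963): "for `D³ ≤ r < 2DP₄` we use
the Mellin transform, Lemma 5.4 (i) and the large sieve inequality."

This file is GLUE ONLY (two short theorems): the per-block bound of the dyadic large-sieve leg
(`Typed.Sec14.legTwo_block_bound(_zero)`, file `Section14LegTwoBlock`, over the coefficient-generic
§7 chain `BErrorChain.*`) is fed into the dyadic aggregation
(`Typed.Sec14.eq148leg2_of_blocks` / `rhs1417OnW_largeR_le_of_blocks`, file
`Section14Eq148Leg2Aggregation`); the only work is matching the range hypotheses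
(`0 < d ↔ 1 ≤ d`, `D³ ≤ R ⇒ 1 ≤ R`, `hR < P ⇒ Rh ≤ P`).

* `eq148leg2_holds : Typed.Sec14.Eq148leg2` — the typed node (β = 0) DISCHARGED;
* `wleg2_holds` — the β-twisted large-conductor leg in the shape consumed by
  `Typed.Sec14.prop141_of_four` / `eq148_of_legsW` (`Section14Prop141OfFour`) and
  `eq145W_of_parts` (`Section14Prop141Twisted`).

## References

* Y. Zhang, arXiv:2211.02515v1 (2022), §14 (14.8) p. 79, tex L3956–L3963.
  [cite: Zhang2022LandauSiegel, §14 (14.8) p. 79]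
-/

noncomputable section

open Finset Real

namespace Literature.NumberTheory.LFunctions.Zhang2022.Typed.Sec14

open Literature.NumberTheory.LFunctions.Zhang2022.Skeleton
open Literature.NumberTheory.LFunctions.Zhang2022.Section7cStatements

/-- `D³ ≤ R` gives `1 ≤ R` once `D ≥ 1`. [folklore] -/
private theorem one_le_of_pow_three_le {D : ℕ} (hD : 1 ≤ D) {R : ℝ} (hR : (D : ℝ) ^ 3 ≤ R) :
    1 ≤ R := by
  have hD1 : (1 : ℝ) ≤ D := by exact_mod_cast hD
  exact le_trans (one_le_pow₀ hD1) hR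

/-- **(14.8), large-conductor leg `D³ ≤ r < 2DP₄`, β = 0: the typed node `Eq148leg2` HOLDS** — the
per-block bound `legTwo_block_bound_zero` (Mellin transform + Lemma 5.4 (i) + the large sieve +
Cauchy on each dyadic block, "in a way similar to the proof of Proposition 7.1") fed into the dyadic
aggregation `eq148leg2_of_blocks`. [cite: Zhang2022LandauSiegel, §14 (14.8) p.79, tex L3962–L3963] -/
theorem eq148leg2_holds : Eq148leg2 := by
  refine eq148leg2_of_blocks fun B => ?_
  obtain ⟨k, C, D₀, hb⟩ := legTwo_block_bound_zero B
  refine ⟨k, C, max D₀ 1, fun D _ χ hD hq hp _ κs hκ d h R hd hd2 hh hR3 _ hhR => ?_⟩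
  have hD₀ : D₀ ≤ D := le_trans (le_max_left _ _) hD
  have hD1 : 1 ≤ D := le_trans (le_max_right _ _) hD
  have hR1 : 1 ≤ R := one_le_of_pow_three_le hD1 hR3
  have hRh : R * h ≤ bigP D := by rw [mul_comm]; exact hhR.le
  exact hb D χ hD₀ hq hp κs hκ d h R (Nat.succ_le_of_lt hd) hd2 (Nat.succ_le_of_lt hh) hR1 hRh

/-- **(14.8), large-conductor leg, β-twisted (`‖β‖ < 5α`): HOLDS** in the shape of the general-β
assembly (`rhs1417OnW` on `(Icc 2 ⌊2DP₄⌋).filter (¬ r < D³)`, weight `(pt₀)^β` inside the `p`-sum) —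
`legTwo_block_bound` fed into `rhs1417OnW_largeR_le_of_blocks`. This is the second input `hleg2` of
`Typed.Sec14.prop141_of_four` / `eq148_of_legsW`.
[cite: Zhang2022LandauSiegel, §14 (14.8) p.79, tex L3962–L3963; p.76 tex L3849] -/
theorem wleg2_holds :
    ∀ B : ℝ, ∃ c : ℝ, 0 < c ∧ ∃ C : ℝ, ForAllLarge fun D _ χ => AssumptionA D χ →
      ∀ β : ℂ, ‖β‖ < 5 * alpha D → ∀ κs as : ℕ → ℂ, Eq141 B κs → Eq142 D B as →
        rhs1417OnW χ β κs ((Finset.Icc 2 ⌊2 * (D : ℝ) * P4 D⌋₊).filter (fun r => ¬ r < D ^ 3))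
          ≤ C * bigP D ^ 2 * (D : ℝ) ^ (-c) := by
  refine rhs1417OnW_largeR_le_of_blocks fun B => ?_
  obtain ⟨k, C, D₀, hb⟩ := legTwo_block_bound B
  refine ⟨k, C, max D₀ 1, fun D _ χ hD hq hp _ β hβ κs hκ d h R hd hd2 hh hR3 _ hhR => ?_⟩
  have hD₀ : D₀ ≤ D := le_trans (le_max_left _ _) hD
  have hD1 : 1 ≤ D := le_trans (le_max_right _ _) hD
  have hR1 : 1 ≤ R := one_le_of_pow_three_le hD1 hR3
  have hRh : R * h ≤ bigP D := by rw [mul_comm]; exact hhR.le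
  exact hb D χ hD₀ hq hp β hβ κs hκ d h R (Nat.succ_le_of_lt hd) hd2 (Nat.succ_le_of_lt hh) hR1 hRh

end Literature.NumberTheory.LFunctions.Zhang2022.Typed.Sec14
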